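import Mathlib
import Summits.NavierStokesRegularity.NavierStokesRegularity.Theorems.EulerZoomLiouvillePowerGaugeEulerLiouvilleDSSPressureSlaving
import HarnessLib

/-!
# Crux E `PowerGaugeEulerLiouville` (stmt-NavierStokesRegularity-19832): DSS PRESSURE SLAVING, step 2 — an EXACTLY discretely
# self-similar representative of the pressure, and the member form (velocity-only DSS strata)

Route №10 `EulerZoomLiouville` (NavierStokesRegularity), crux E.  Step 1 (`…DSSPressureSlaving`): for a DSS velocity of factor `l > 1` in
the class, `p(s,y) = l^{2(1+ρ)} p(l^{2+ρ}s, l y)` for a.e. `(s,y)` in the slab.  Here: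

* `DSSPressureSlaving.ae_forall_zpow` — iterating the one-scale identity along the (quasi-measure-preserving) dilations: for a.e. `(s, y)` in
  the slab and EVERY `k ∈ ℤ`, `p̄(s,y) = (l^{2(1+ρ)})^k p̄(β^k s, l^k y)` (`β = l^{2+ρ}`, `p̄` a strongly measurable modification of `p`);
* the representative `p̃(s,y) := (l^{2(1+ρ)})^{k(s)} p̄(β^{k(s)} s, l^{k(s)} y)`, `k(s) = −⌊log_β(−s)⌋` (`DSSPressureSlaving.floor_logb_mul`:
  `k(β s) = k(s) − 1`), is EXACTLY DSS for all `s < 0` and `p̃ = p` a.e. on the slab (for a.e. `z` the identity holds at `k = k(z₁)`);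
* `DSSPressureSlaving.inClass_dssPressure` — **MEMBER FORM**, crux binders verbatim (`ρ > −1/2`): `InClass ρ u p H c` + the DSS velocity
  clause ⇒ there is `p̃` with the DSS pressure clause `∀ τ<0, ∀ y, p̃ τ y = l^{2(1+ρ)} p̃(l^{2+ρ}τ, l y)` EXACTLY and `InClass ρ u p̃ H c`
  (ns-ezl-w2 g2's swap `PressureSwap.inClass_congr_pressure_ae`) — the LEAD may delete the pressure clause of the DSS strata.

WHAT THIS IS NOT: not NS, not E — a de-conditioning lemma for the census of the crux CLASS 19832; `--supports` stmt-19832.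
[folklore; RusinSverak2011 §2 p. 4; CaffarelliKohnNirenberg1982 §2]
-/

noncomputable section

-- flat `Theorems/<Route><Decl>…` files of one crux share the namespace of the crux (tree convention)
set_option linter.dupNamespace false

open MeasureTheory Set Filter Topology Metric Function TopologicalSpace
open scoped ENNReal NNReal

namespace Summit.NavierStokesRegularity.NavierStokesRegularity.Theorems.PowerGaugeEulerLiouville

open Literature.Analysis Literature.Analysis.FunctionSpaces Literature.Analysis.FluidPDE PressureSlaving

namespace DSSPressureSlaving

section Iterate

variable {P : ℝ × EuclideanSpace ℝ (Fin 3) → ℝ} {A β γ : ℝ}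

/-- The dilation `(s, y) ↦ (b s, c y)` (`b > 0`) maps the slab `(−∞,0) × ℝ³` into itself. [folklore] -/
theorem mem_slab_of_dilate {b c : ℝ} (hb : 0 < b) {z : ℝ × EuclideanSpace ℝ (Fin 3)}
    (hz : z ∈ Iio (0 : ℝ) ×ˢ (univ : Set (EuclideanSpace ℝ (Fin 3)))) :
    (b * z.1, c • z.2) ∈ Iio (0 : ℝ) ×ˢ (univ : Set (EuclideanSpace ℝ (Fin 3))) :=
  mem_prod.2 ⟨mul_neg_of_pos_of_neg hb (mem_prod.1 hz).1, mem_univ _⟩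

/-- **Iteration along the dilation group.**  If `P(z) = A · P(β z₁, γ z₂)` for a.e. `z` in the slab (`A ≠ 0`, `β, γ > 0`), then for
every `k ∈ ℤ`, `P(z) = A^k · P(β^k z₁, γ^k z₂)` for a.e. `z` in the slab (the dilations are quasi-measure-preserving,
`PressureSlaving.quasiMeasurePreserving_selfSimilarMap`). [folklore] -/
theorem ae_zpow_of_ae_one (hA : A ≠ 0) (hβ : 0 < β) (hγ : 0 < γ)
    (h : ∀ᵐ z : ℝ × EuclideanSpace ℝ (Fin 3), z ∈ Iio (0 : ℝ) ×ˢ (univ : Set (EuclideanSpace ℝ (Fin 3))) →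
      P z = A * P (β * z.1, γ • z.2)) (k : ℤ) :
    ∀ᵐ z : ℝ × EuclideanSpace ℝ (Fin 3), z ∈ Iio (0 : ℝ) ×ˢ (univ : Set (EuclideanSpace ℝ (Fin 3))) →
      P z = A ^ k * P (β ^ k * z.1, γ ^ k • z.2) := by
  -- natural powers first
  have hnat : ∀ n : ℕ, ∀ᵐ z : ℝ × EuclideanSpace ℝ (Fin 3), z ∈ Iio (0 : ℝ) ×ˢ (univ : Set (EuclideanSpace ℝ (Fin 3))) →
      P z = A ^ n * P (β ^ n * z.1, γ ^ n • z.2) := by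
    intro n
    induction n with
    | zero =>
      exact Eventually.of_forall fun z _ => by simp
    | succ n ih =>
      -- transport the one-step identity to the point `(βⁿ z₁, γⁿ z₂)`
      have hq := quasiMeasurePreserving_selfSimilarMap (β := β ^ n) (c := γ ^ n) (pow_ne_zero _ hβ.ne') (pow_ne_zero _ hγ.ne')
      have h' := hq.ae h
      filter_upwards [ih, h'] with z hz hz' hzS
      have hS' : ((β ^ n) * z.1, (γ ^ n) • z.2) ∈ Iio (0 : ℝ) ×ˢ (univ : Set (EuclideanSpace ℝ (Fin 3))) :=
        mem_slab_of_dilate (pow_pos hβ n) hzS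
      rw [hz hzS, hz' hS', ← mul_assoc, ← mul_assoc, smul_smul, pow_succ, pow_succ, pow_succ]
      congr 2
      ring_nf
  -- integers: `k = n` or `k = −n`
  obtain ⟨n, rfl | rfl⟩ := k.eq_nat_or_neg
  · simpa only [zpow_natCast] using hnat n
  · -- transport `hnat n` under the inverse dilation `(β⁻ⁿ, γ⁻ⁿ)`
    have hq := quasiMeasurePreserving_selfSimilarMap (β := (β ^ n)⁻¹) (c := (γ ^ n)⁻¹)
      (inv_ne_zero (pow_ne_zero _ hβ.ne')) (inv_ne_zero (pow_ne_zero _ hγ.ne'))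
    have h' := hq.ae (hnat n)
    filter_upwards [h'] with z hz hzS
    have hS' : ((β ^ n)⁻¹ * z.1, (γ ^ n)⁻¹ • z.2) ∈ Iio (0 : ℝ) ×ˢ (univ : Set (EuclideanSpace ℝ (Fin 3))) :=
      mem_slab_of_dilate (inv_pos.2 (pow_pos hβ n)) hzS
    have e := hz hS'
    simp only [← mul_assoc, smul_smul, mul_inv_cancel₀ (pow_ne_zero _ hβ.ne'), mul_inv_cancel₀ (pow_ne_zero _ hγ.ne'),
      one_mul, one_smul] at e
    -- `e : P ((βⁿ)⁻¹ z₁, (γⁿ)⁻¹ z₂) = Aⁿ P z`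
    have hAn : A ^ n ≠ 0 := pow_ne_zero _ hA
    rw [zpow_neg, zpow_natCast, zpow_neg, zpow_natCast, zpow_neg, zpow_natCast]
    have : P z = (A ^ n)⁻¹ * P ((β ^ n)⁻¹ * z.1, (γ ^ n)⁻¹ • z.2) := by
      rw [e, ← mul_assoc, inv_mul_cancel₀ hAn, one_mul]
    simpa only [Prod.mk.eta] using this

end Iterate

section Rep

/-- `⌊log_β(β x)⌋ = ⌊log_β x⌋ + 1` for `x > 0`, `β > 1` (the period index shifts by one under the dilation). [folklore] -/
theorem floor_logb_mul {β x : ℝ} (hβ : 1 < β) (hx : 0 < x) :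
    ⌊Real.logb β (β * x)⌋ = ⌊Real.logb β x⌋ + 1 := by
  have hβ0 : 0 < β := by linarith
  rw [Real.logb_mul hβ0.ne' hx.ne', Real.logb_self_eq_one hβ, add_comm, Int.floor_add_one]

end Rep

section Member

variable {u : ℝ → EuclideanSpace ℝ (Fin 3) → EuclideanSpace ℝ (Fin 3)} {p : ℝ → EuclideanSpace ℝ (Fin 3) → ℝ}
  {H : ℝ → EuclideanSpace ℝ (Fin 3) → EuclideanSpace ℝ (Fin 3) →L[ℝ] EuclideanSpace ℝ (Fin 3)} {c : ℝ≥0}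

/-- **DSS PRESSURE SLAVING (member form, crux binders verbatim).**  In Seregin's power-gauged class (any `ρ > −1/2`), if the velocity is
discretely self-similar with factor `l > 1`, `u(τ, y) = l^{1+ρ} u(l^{2+ρ}τ, l y)` for `τ < 0`, then there is a pressure `p̃`, EXACTLY discretely
self-similar (`p̃(τ, y) = l^{2(1+ρ)} p̃(l^{2+ρ}τ, l y)` for all `τ < 0`, `y`), with `p̃ = p` a.e. on the slab and `InClass ρ u p̃ H c` with the SAME
`c`.  The LEAD may delete the pressure clause of every DSS stratum. [folklore; RusinSverak2011 §2 p. 4; CaffarelliKohnNirenberg1982 §2] -/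
theorem inClass_dssPressure {ρ l : ℝ} (hρ : -1 / 2 < ρ) (hl : 1 < l)
    (hcls : IsSuitableWeakSolutionOn (slab (EuclideanSpace ℝ (Fin 3)) (Iio 0) isOpen_Iio) 0 0 u p ∧
      HasWeakSpatialGradientOn (slab (EuclideanSpace ℝ (Fin 3)) (Iio 0) isOpen_Iio) u H ∧
      (∀ a : ℝ, 0 < a →
        ENNReal.ofReal (a ^ (2 * ρ)) * cknA a (0 : ℝ × EuclideanSpace ℝ (Fin 3)) u +
              ENNReal.ofReal (a ^ ρ) * cknE a (0 : ℝ × EuclideanSpace ℝ (Fin 3)) H +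
            ENNReal.ofReal (a ^ (2 * ρ)) * cknD a (0 : ℝ × EuclideanSpace ℝ (Fin 3)) p ≤ (c : ℝ≥0∞)))
    (hu : ∀ τ : ℝ, τ < 0 → ∀ y, u τ y = (l ^ (1 + ρ)) • u ((l ^ (2 + ρ)) * τ) (l • y)) :
    ∃ p' : ℝ → EuclideanSpace ℝ (Fin 3) → ℝ,
      (∀ τ : ℝ, τ < 0 → ∀ y, p' τ y = (l ^ (2 * (1 + ρ))) * p' ((l ^ (2 + ρ)) * τ) (l • y)) ∧
      (∀ᵐ z ∂(volume.restrict (Iio (0 : ℝ) ×ˢ (univ : Set (EuclideanSpace ℝ (Fin 3))))), p' z.1 z.2 = p z.1 z.2) ∧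
      (IsSuitableWeakSolutionOn (slab (EuclideanSpace ℝ (Fin 3)) (Iio 0) isOpen_Iio) 0 0 u p' ∧
        HasWeakSpatialGradientOn (slab (EuclideanSpace ℝ (Fin 3)) (Iio 0) isOpen_Iio) u H ∧
        (∀ a : ℝ, 0 < a →
          ENNReal.ofReal (a ^ (2 * ρ)) * cknA a (0 : ℝ × EuclideanSpace ℝ (Fin 3)) u +
                ENNReal.ofReal (a ^ ρ) * cknE a (0 : ℝ × EuclideanSpace ℝ (Fin 3)) H +
              ENNReal.ofReal (a ^ (2 * ρ)) * cknD a (0 : ℝ × EuclideanSpace ℝ (Fin 3)) p' ≤ (c : ℝ≥0∞))) := by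
  obtain ⟨hsw, hH, hc⟩ := hcls
  have hl0 : 0 < l := by linarith
  set A : ℝ := (l ^ (1 + ρ)) ^ 2 with hAdef
  set β : ℝ := l ^ (2 + ρ) with hβdef
  have hA : A ≠ 0 := pow_ne_zero _ (Real.rpow_pos_of_pos hl0 _).ne'
  have hβ1 : 1 < β := Real.one_lt_rpow hl (by linarith)
  have hβ0 : 0 < β := by linarith
  -- step 1: `p = p_l` a.e. on the slab
  have hcD : ∀ a : ℝ, 0 < a →
      ENNReal.ofReal (a ^ (2 * ρ)) * cknD a (0 : ℝ × EuclideanSpace ℝ (Fin 3)) p ≤ (c : ℝ≥0∞) :=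
    fun a ha => le_trans le_add_self (hc a ha)
  have hD : ∀ a : ℝ, 1 ≤ a →
      ∫⁻ z in parabolicCylinder a (0 : ℝ × EuclideanSpace ℝ (Fin 3)), ‖p z.1 z.2‖ₑ ^ (3 / 2 : ℝ) ≤
        (c : ℝ≥0∞) * ENNReal.ofReal (a ^ (2 - 2 * ρ)) :=
    fun a ha => lintegral_cylinder_le_of_gaugeD hcD (one_pos.trans_le ha)
  have hae := ae_eq_dssPressure hl hsw.distributional ENNReal.coe_ne_top (m := 2 - 2 * ρ) (by linarith) hD hu
  -- a strongly measurable modification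
  have hpm : AEStronglyMeasurable (uncurry p)
      (volume.restrict (Iio (0 : ℝ) ×ˢ (univ : Set (EuclideanSpace ℝ (Fin 3))))) := by
    have h := hsw.distributional.2.2.1.aestronglyMeasurable; rwa [coe_slab] at h
  set P : ℝ × EuclideanSpace ℝ (Fin 3) → ℝ := hpm.mk (uncurry p) with hPdef
  have hPm : Measurable P := hpm.stronglyMeasurable_mk.measurable
  have hPp : ∀ᵐ z : ℝ × EuclideanSpace ℝ (Fin 3), z ∈ Iio (0 : ℝ) ×ˢ (univ : Set (EuclideanSpace ℝ (Fin 3))) →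
      P z = p z.1 z.2 := by
    have h := (ae_restrict_iff' (measurableSet_Iio.prod MeasurableSet.univ)).1 hpm.ae_eq_mk
    filter_upwards [h] with z hz hzS
    exact (hz hzS).symm
  -- the one-scale identity for `P`
  have hq := quasiMeasurePreserving_selfSimilarMap (β := β) (c := l) hβ0.ne' hl0.ne'
  have hP1 : ∀ᵐ z : ℝ × EuclideanSpace ℝ (Fin 3), z ∈ Iio (0 : ℝ) ×ˢ (univ : Set (EuclideanSpace ℝ (Fin 3))) →
      P z = A * P (β * z.1, l • z.2) := by
    have h1 := (ae_restrict_iff' (measurableSet_Iio.prod MeasurableSet.univ)).1 hae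
    have h2 := hq.ae hPp
    filter_upwards [hPp, h1, h2] with z hz0 hz1 hz2 hzS
    have hS' : (β * z.1, l • z.2) ∈ Iio (0 : ℝ) ×ˢ (univ : Set (EuclideanSpace ℝ (Fin 3))) := mem_slab_of_dilate hβ0 hzS
    rw [hz0 hzS, hz1 hzS, hz2 hS']
  -- the representative `p'(s, y) := A^{k(s)} P(β^{k(s)} s, l^{k(s)} y)`, `k(s) = −⌊log_β(−s)⌋`
  set k : ℝ → ℤ := fun s => -⌊Real.logb β (-s)⌋ with hkdef
  have hk : ∀ s : ℝ, s < 0 → k (β * s) = k s - 1 := by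
    intro s hs
    simp only [hkdef]
    rw [show -(β * s) = β * (-s) by ring, floor_logb_mul hβ1 (neg_pos.2 hs)]
    ring
  set p' : ℝ → EuclideanSpace ℝ (Fin 3) → ℝ := fun s y => A ^ k s * P (β ^ k s * s, l ^ k s • y) with hp'def
  have hp'ae : ∀ᵐ z ∂(volume.restrict (Iio (0 : ℝ) ×ˢ (univ : Set (EuclideanSpace ℝ (Fin 3))))), p' z.1 z.2 = p z.1 z.2 := by
    refine (ae_restrict_iff' (measurableSet_Iio.prod MeasurableSet.univ)).2 ?_
    have hall := ae_all_iff.2 fun j : ℤ => ae_zpow_of_ae_one hA hβ0 hl0 hP1 j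
    filter_upwards [hall, hPp] with z hz hz0 hzS
    have e := hz (k z.1) hzS
    rw [hp'def]
    simp only
    rw [← hz0 hzS, e]
  refine ⟨p', fun τ hτ y => ?_, hp'ae, PressureSwap.inClass_congr_pressure_ae ⟨hsw, hH, hc⟩ ?_⟩
  · -- exact DSS: `k(βτ) = k(τ) − 1`
    have eA : (l ^ (2 * (1 + ρ))) = A := by
      rw [hAdef, ← Real.rpow_natCast, ← Real.rpow_mul hl0.le]; ring_nf
    rw [eA, hp'def]
    simp only
    rw [hk τ hτ, smul_smul, ← mul_assoc A]
    have e1 : A * A ^ (k τ - 1) = A ^ k τ := by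
      rw [zpow_sub_one₀ hA, mul_comm, mul_assoc, inv_mul_cancel₀ hA, mul_one]
    have e2 : β ^ (k τ - 1) * (β * τ) = β ^ k τ * τ := by
      rw [zpow_sub_one₀ hβ0.ne', ← mul_assoc, mul_assoc _ β⁻¹ β, inv_mul_cancel₀ hβ0.ne', mul_one]
    have e3 : l ^ (k τ - 1) * l = l ^ k τ := by
      rw [zpow_sub_one₀ hl0.ne', mul_assoc, inv_mul_cancel₀ hl0.ne', mul_one]
    rw [e1, e2, e3]
  · filter_upwards [hp'ae] with z hz
    simpa only [uncurry] using hz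

end Member

end DSSPressureSlaving

end Summit.NavierStokesRegularity.NavierStokesRegularity.Theorems.PowerGaugeEulerLiouville
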